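import Mathlib
import Summits.Ventures.PercRepro2.CrossAPrimeSupport
import Summits.Ventures.PercRepro2.CrossAPrimeRootEdge

/-!
# The induction that closes the sign of `crossA′so` modulo the root-edge reduction
(blind cell PercRepro2, p5 g32; `proofs/P5-OEDGE.md` §42 (14), S4 §2.4 (s) addendum 20 (14))

**`crossA'so_nonneg_of_rootEdge`**: if for every root `r`, every edge `e = {r, w}` (`w ≠ r`) of
random weight `q = p e ∉ {0, 1}` the ROOT-EDGE REDUCTION `(1 − q)²·crossA′so(p[e ↦ 0]) ≤ crossA′so(p)`
holds (with root `r`), then `0 ≤ crossA′so(p)` for every `p`. Induction on the number of random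
edges: (i) a random loop is removed (`crossA'so_update_loop`); (ii) a random edge at the DETERMINISTIC
cluster `S` of the root (`cluster ends (sureConfig p) a₁`, the vertices joined to `a₁` through
weight-1 edges) is split after RE-ROOTING at its endpoint `t ∈ S` (`crossA'so_reroot`: the masses
only see the events on the support `supp p`, where `a₁ ↔ t` is sure); (iii) if every edge at `S` is
deterministic, `C(a₁) = S` surely and `crossA′so` is `[a₂ ∉ S]·[v ∈ S]·(2P(oH,bH) − P(oH)P(bH)) ≥ 0`
(Harris). The reduction is a theorem for `w = a₂` (`crossA'so_root_edge`) and for `w = v`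
(`crossA'so_a1v_edge`); for the other `w` it is the open statement `RootEdgeReduction`.
Own work; standard axioms.
-/

namespace Summit.Ventures.PercRepro2

open LeafRowPendantRootSO CrossAPrimeA1VMid CrossAPrimeSupport CrossAPrimeRootEdge

namespace CrossAPrimeInduction

section Base

variable {V : Type*} {E : Type*} [Fintype E] [DecidableEq E] [Fintype V] [DecidableEq V]
  {R : Type*} [Field R] [LinearOrder R] [IsStrictOrderedRing R]
variable {ends : E → Sym2 V}

omit [Fintype E] [DecidableEq E] [Fintype V] [DecidableEq V] [LinearOrder R]
  [IsStrictOrderedRing R] in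
/-- If every edge at the deterministic cluster `S = C_{sure}(a₁)` is deterministic, then on the
support `C(a₁) = S`. -/
lemma cluster_eq_of_det {p : E → R} {a₁ : V}
    (hdet : ∀ e ∈ touches ends (cluster ends (sureConfig p) a₁), p e = 0 ∨ p e = 1)
    {ω : Config E} (hω : ω ∈ supp p) :
    cluster ends ω a₁ = cluster ends (sureConfig p) a₁ := by
  apply cluster_eq_of_eqOn_touches (ω := sureConfig p) _ rfl
  intro e he
  rcases hdet e he with h0 | h1
  · rw [(hω e).2 h0]
    simp [sureConfig, h0]
  · rw [(hω e).1 h1]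
    simp [sureConfig, h1]

omit [Fintype E] [DecidableEq E] [Fintype V] [DecidableEq V] [LinearOrder R]
  [IsStrictOrderedRing R] in
/-- On the support, `Q = ∅` when `a₂ ∈ S`. -/
lemma avoid_inter_supp_of_mem {p : E → R} {a₁ : V}
    (hdet : ∀ e ∈ touches ends (cluster ends (sureConfig p) a₁), p e = 0 ∨ p e = 1) {a₂ : V}
    (ha : a₂ ∈ cluster ends (sureConfig p) a₁) :
    avoidAll ends a₂ {a₁} ∩ supp p = (∅ : Set (Config E)) ∩ supp p := by
  rw [Set.empty_inter]
  ext ω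
  simp only [Set.mem_inter_iff, mem_avoidAll, Finset.mem_singleton, forall_eq,
    Set.mem_empty_iff_false, iff_false, not_and]
  intro h1 hω
  apply h1
  have : a₂ ∈ cluster ends ω a₁ := by
    rw [cluster_eq_of_det hdet hω]
    exact ha
  exact conn_symm this

omit [Fintype E] [DecidableEq E] [Fintype V] [DecidableEq V] [LinearOrder R]
  [IsStrictOrderedRing R] in
/-- On the support, `Q` is everything when `a₂ ∉ S`. -/
lemma avoid_inter_supp_of_not_mem {p : E → R} {a₁ : V}
    (hdet : ∀ e ∈ touches ends (cluster ends (sureConfig p) a₁), p e = 0 ∨ p e = 1) {a₂ : V}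
    (ha : a₂ ∉ cluster ends (sureConfig p) a₁) :
    avoidAll ends a₂ {a₁} ∩ supp p = (Set.univ : Set (Config E)) ∩ supp p := by
  rw [Set.univ_inter]
  ext ω
  simp only [Set.mem_inter_iff, mem_avoidAll, Finset.mem_singleton, forall_eq]
  constructor
  · exact fun h => h.2
  · intro hω
    refine ⟨fun hc => ha ?_, hω⟩
    rw [← cluster_eq_of_det hdet hω]
    exact conn_symm hc

omit [Fintype E] [DecidableEq E] [Fintype V] [DecidableEq V] [LinearOrder R]
  [IsStrictOrderedRing R] in
/-- On the support, `vL` is everything when `v ∈ S`. -/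
lemma connEvent_inter_supp_of_mem {p : E → R} {a₁ : V}
    (hdet : ∀ e ∈ touches ends (cluster ends (sureConfig p) a₁), p e = 0 ∨ p e = 1) {v : V}
    (hv : v ∈ cluster ends (sureConfig p) a₁) :
    connEvent ends a₁ v ∩ supp p = (Set.univ : Set (Config E)) ∩ supp p := by
  rw [Set.univ_inter]
  ext ω
  simp only [Set.mem_inter_iff, connEvent, Set.mem_setOf_eq]
  constructor
  · exact fun h => h.2
  · intro hω
    refine ⟨?_, hω⟩
    have : v ∈ cluster ends ω a₁ := by
      rw [cluster_eq_of_det hdet hω]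
      exact hv
    exact this

omit [Fintype E] [DecidableEq E] [Fintype V] [DecidableEq V] [LinearOrder R]
  [IsStrictOrderedRing R] in
/-- On the support, `vL = ∅` when `v ∉ S`. -/
lemma connEvent_inter_supp_of_not_mem {p : E → R} {a₁ : V}
    (hdet : ∀ e ∈ touches ends (cluster ends (sureConfig p) a₁), p e = 0 ∨ p e = 1) {v : V}
    (hv : v ∉ cluster ends (sureConfig p) a₁) :
    connEvent ends a₁ v ∩ supp p = (∅ : Set (Config E)) ∩ supp p := by
  rw [Set.empty_inter]
  ext ω
  simp only [Set.mem_inter_iff, connEvent, Set.mem_setOf_eq, Set.mem_empty_iff_false, iff_false,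
    not_and]
  intro h1 hω
  apply hv
  rw [← cluster_eq_of_det hdet hω]
  exact h1

omit [Fintype V] [DecidableEq V] in
/-- **The base case**: if every edge at the deterministic cluster of `a₁` is deterministic,
`0 ≤ crossA′so(p)` (it is `0` or `2P(oH,bH) − P(oH)P(bH)`, Harris). -/
theorem crossA'so_nonneg_of_det {p : E → R} (hp : IsProbVec p) {a₁ : V}
    (hdet : ∀ e ∈ touches ends (cluster ends (sureConfig p) a₁), p e = 0 ∨ p e = 1)
    (o a₂ v b : V) : 0 ≤ crossA'so p ends o a₁ a₂ v b := by
  by_cases ha : a₂ ∈ cluster ends (sureConfig p) a₁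
  · rw [crossA'so_congr_supp p o a₁ a₂ v b (avoid_inter_supp_of_mem hdet ha) rfl]
    simp
  · by_cases hvS : v ∈ cluster ends (sureConfig p) a₁
    · rw [crossA'so_congr_supp p o a₁ a₂ v b (avoid_inter_supp_of_not_mem hdet ha)
        (connEvent_inter_supp_of_mem hdet hvS)]
      simp only [Set.univ_inter, prob_univ]
      have hH := prob_mul_prob_le_prob_inter hp (isUpperSet_connEvent ends a₂ o)
        (isUpperSet_connEvent ends a₂ b)
      have h0 := prob_nonneg hp (connEvent ends a₂ o ∩ connEvent ends a₂ b)
      nlinarith [hH, h0]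
    · rw [crossA'so_congr_supp p o a₁ a₂ v b (avoid_inter_supp_of_not_mem hdet ha)
        (connEvent_inter_supp_of_not_mem hdet hvS)]
      simp

end Base

section Induction

variable {V : Type*} {E : Type*} [Fintype E] [DecidableEq E] [Fintype V] [DecidableEq V]
  {R : Type*} [Field R] [LinearOrder R] [IsStrictOrderedRing R]
variable {ends : E → Sym2 V}

/-- The random edges of `p`. -/
def randomEdges (p : E → R) : Finset E := Finset.univ.filter (fun e => p e ≠ 0 ∧ p e ≠ 1)

omit [Fintype V] [DecidableEq V] [IsStrictOrderedRing R] in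
/-- Pinning a random edge removes it from the random edges. -/
lemma randomEdges_update_zero (p : E → R) (e : E) :
    randomEdges (Function.update p e 0) = (randomEdges p).erase e := by
  ext f
  simp only [randomEdges, Finset.mem_filter, Finset.mem_univ, true_and, Finset.mem_erase]
  by_cases hf : f = e
  · subst hf
    simp
  · simp [hf]

/-- **The root-edge reduction** (the open statement for `w ∉ {a₂, v}`): for every root `r` and
every non-loop edge `e = {r, w}` of random weight, `(1 − p e)²·crossA′so(p[e ↦ 0]) ≤ crossA′so(p)`
with root `r`. -/
def RootEdgeReduction (ends : E → Sym2 V) (o a₂ v b : V) : Prop :=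
  ∀ (p : E → R) (r w : V) (e : E), IsProbVec p → ends e = s(r, w) → r ≠ w → p e ≠ 0 → p e ≠ 1 →
    (1 - p e) ^ 2 * crossA'so (Function.update p e 0) ends o r a₂ v b ≤
      crossA'so p ends o r a₂ v b

/-- **The induction**: the root-edge reduction for every root gives `0 ≤ crossA′so(p)` for every
`p`, by induction on the number of random edges (loops removed, random edges at the deterministic
cluster of the root split after re-rooting, the deterministic base by Harris). -/
theorem crossA'so_nonneg_of_rootEdge {o a₂ v b : V}
    (H : RootEdgeReduction (R := R) ends o a₂ v b) :
    ∀ (p : E → R), IsProbVec p → ∀ a₁, 0 ≤ crossA'so p ends o a₁ a₂ v b := by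
  suffices h : ∀ n, ∀ (p : E → R), IsProbVec p → (randomEdges p).card = n →
      ∀ a₁, 0 ≤ crossA'so p ends o a₁ a₂ v b from fun p hp a₁ => h _ p hp rfl a₁
  intro n
  induction n with
  | zero =>
    intro p hp hcard a₁
    apply crossA'so_nonneg_of_det hp
    intro e _
    by_contra hne
    rw [not_or] at hne
    have : e ∈ randomEdges p := by
      simp only [randomEdges, Finset.mem_filter, Finset.mem_univ, true_and]
      exact hne
    rw [Finset.card_eq_zero] at hcard
    rw [hcard] at this
    exact absurd this (Finset.notMem_empty e)
  | succ n ih =>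
    intro p hp hcard a₁
    by_cases hdet : ∀ e ∈ touches ends (cluster ends (sureConfig p) a₁), p e = 0 ∨ p e = 1
    · exact crossA'so_nonneg_of_det hp hdet o a₂ v b
    · simp only [not_forall, not_or] at hdet
      obtain ⟨e, he, h0, h1⟩ := hdet
      obtain ⟨t, ht, w, hew⟩ := he
      have hp0 : IsProbVec (Function.update p e 0) := hp.update e le_rfl zero_le_one
      have hcard0 : (randomEdges (Function.update p e 0)).card = n := by
        rw [randomEdges_update_zero, Finset.card_erase_of_mem, hcard]
        · rfl
        · simp only [randomEdges, Finset.mem_filter, Finset.mem_univ, true_and]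
          exact ⟨h0, h1⟩
      have hind := ih _ hp0 hcard0 a₁
      by_cases htw : t = w
      · -- a random loop: remove it
        subst htw
        rw [crossA'so_update_loop hew p o a₁ a₂ v b] at hind
        exact hind
      · -- re-root at `t ∈ S`, split along `e = {t, w}`
        have htc : Conn ends (sureConfig p) a₁ t := ht
        have hre := crossA'so_reroot (R := R) p htc o a₂ v b
        have hsure := sureConfig_update_zero (R := R) p h1
        have htc0 : Conn ends (sureConfig (Function.update p e 0)) a₁ t := by
          rw [hsure]
          exact htc
        have hre0 := crossA'so_reroot (R := R) (Function.update p e 0) htc0 o a₂ v b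
        have hH := H p t w e hp hew htw h0 h1
        rw [hre]
        rw [hre0] at hind
        have := mul_nonneg (sq_nonneg (1 - p e)) hind
        linarith [hH, this]

/-- **The open statement, minimal form**: the root-edge reduction for the edges `{r, w}` with
`w ∉ {a₂, v}` (the edges to `a₂` and to `v` are theorems). -/
def RootEdgeReductionGeneric (ends : E → Sym2 V) (o a₂ v b : V) : Prop :=
  ∀ (p : E → R) (r w : V) (e : E), IsProbVec p → ends e = s(r, w) → r ≠ w → w ≠ a₂ → w ≠ v →
    p e ≠ 0 → p e ≠ 1 →
    (1 - p e) ^ 2 * crossA'so (Function.update p e 0) ends o r a₂ v b ≤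
      crossA'so p ends o r a₂ v b

/-- The edges to `a₂` (`crossA'so_root_edge`) and to `v` (`crossA'so_a1v_edge`) are free, so the
generic reduction gives the full one. -/
theorem rootEdgeReduction_of_generic {o a₂ v b : V}
    (H : RootEdgeReductionGeneric (R := R) ends o a₂ v b) :
    RootEdgeReduction (R := R) ends o a₂ v b := by
  intro p r w e hp he hrw h0 h1
  by_cases hw2 : w = a₂
  · subst hw2
    exact crossA'so_root_edge hp he
  · by_cases hwv : w = v
    · subst hwv
      exact crossA'so_a1v_edge hp he o a₂ b
    · exact H p r w e hp he hrw hw2 hwv h0 h1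

/-- **The sign of `crossA′so` modulo the generic root-edge reduction.** -/
theorem crossA'so_nonneg_of_generic {o a₂ v b : V}
    (H : RootEdgeReductionGeneric (R := R) ends o a₂ v b) (p : E → R) (hp : IsProbVec p)
    (a₁ : V) : 0 ≤ crossA'so p ends o a₁ a₂ v b :=
  crossA'so_nonneg_of_rootEdge (rootEdgeReduction_of_generic H) p hp a₁

omit [Fintype V] [DecidableEq V] [IsStrictOrderedRing R] in
/-- Pinning a random edge open removes it from the random edges. -/
lemma randomEdges_update_one (p : E → R) (e : E) :
    randomEdges (Function.update p e 1) = (randomEdges p).erase e := by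
  ext f
  simp only [randomEdges, Finset.mem_filter, Finset.mem_univ, true_and, Finset.mem_erase]
  by_cases hf : f = e
  · subst hf
    simp
  · simp [hf]

/-- **The open statement, inductive form**: the generic root-edge reduction only has to be proved
for weight vectors at which the sign already holds after pinning the edge closed and open
(`B₀ ≥ 0`, `B₃ ≥ 0` — the induction hypotheses); so it never contains an instance of the sign
itself (e.g. an edge inside the sure cluster of the root, where the reduction IS the sign at
`p[e ↦ 0]`). -/
def RootEdgeReductionStep (ends : E → Sym2 V) (o a₂ v b : V) : Prop :=
  ∀ (p : E → R) (r w : V) (e : E), IsProbVec p → ends e = s(r, w) → r ≠ w → w ≠ a₂ → w ≠ v →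
    p e ≠ 0 → p e ≠ 1 →
    0 ≤ crossA'so (Function.update p e 0) ends o r a₂ v b →
    0 ≤ crossA'so (Function.update p e 1) ends o r a₂ v b →
    (1 - p e) ^ 2 * crossA'so (Function.update p e 0) ends o r a₂ v b ≤
      crossA'so p ends o r a₂ v b

/-- **The induction, inductive form**: `RootEdgeReductionStep` gives `0 ≤ crossA′so(p)` for every
`p` and every root. -/
theorem crossA'so_nonneg_of_step {o a₂ v b : V}
    (H : RootEdgeReductionStep (R := R) ends o a₂ v b) :
    ∀ (p : E → R), IsProbVec p → ∀ a₁, 0 ≤ crossA'so p ends o a₁ a₂ v b := by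
  suffices h : ∀ n, ∀ (p : E → R), IsProbVec p → (randomEdges p).card = n →
      ∀ a₁, 0 ≤ crossA'so p ends o a₁ a₂ v b from fun p hp a₁ => h _ p hp rfl a₁
  intro n
  induction n with
  | zero =>
    intro p hp hcard a₁
    apply crossA'so_nonneg_of_det hp
    intro e _
    by_contra hne
    rw [not_or] at hne
    have : e ∈ randomEdges p := by
      simp only [randomEdges, Finset.mem_filter, Finset.mem_univ, true_and]
      exact hne
    rw [Finset.card_eq_zero] at hcard
    rw [hcard] at this
    exact absurd this (Finset.notMem_empty e)
  | succ n ih =>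
    intro p hp hcard a₁
    by_cases hdet : ∀ e ∈ touches ends (cluster ends (sureConfig p) a₁), p e = 0 ∨ p e = 1
    · exact crossA'so_nonneg_of_det hp hdet o a₂ v b
    · simp only [not_forall, not_or] at hdet
      obtain ⟨e, he, h0, h1⟩ := hdet
      obtain ⟨t, ht, w, hew⟩ := he
      have hp0 : IsProbVec (Function.update p e 0) := hp.update e le_rfl zero_le_one
      have hp1 : IsProbVec (Function.update p e 1) := hp.update e zero_le_one le_rfl
      have hmem : e ∈ randomEdges p := by
        simp only [randomEdges, Finset.mem_filter, Finset.mem_univ, true_and]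
        exact ⟨h0, h1⟩
      have hcard0 : (randomEdges (Function.update p e 0)).card = n := by
        rw [randomEdges_update_zero, Finset.card_erase_of_mem hmem, hcard]
        rfl
      have hcard1 : (randomEdges (Function.update p e 1)).card = n := by
        rw [randomEdges_update_one, Finset.card_erase_of_mem hmem, hcard]
        rfl
      have hind := ih _ hp0 hcard0 a₁
      by_cases htw : t = w
      · subst htw
        rw [crossA'so_update_loop hew p o a₁ a₂ v b] at hind
        exact hind
      · by_cases hw2 : w = a₂
        · subst hw2
          have htc : Conn ends (sureConfig p) a₁ t := ht
          rw [crossA'so_reroot (R := R) p htc o w v b]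
          have hsure := sureConfig_update_zero (R := R) p h1
          have htc0 : Conn ends (sureConfig (Function.update p e 0)) a₁ t := by
            rw [hsure]
            exact htc
          rw [crossA'so_reroot (R := R) (Function.update p e 0) htc0 o w v b] at hind
          have hH := crossA'so_root_edge hp hew (o := o) (v := v) (b := b)
          have := mul_nonneg (sq_nonneg (1 - p e)) hind
          linarith [hH, this]
        · by_cases hwv : w = v
          · subst hwv
            have htc : Conn ends (sureConfig p) a₁ t := ht
            rw [crossA'so_reroot (R := R) p htc o a₂ w b]
            have hsure := sureConfig_update_zero (R := R) p h1
            have htc0 : Conn ends (sureConfig (Function.update p e 0)) a₁ t := by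
              rw [hsure]
              exact htc
            rw [crossA'so_reroot (R := R) (Function.update p e 0) htc0 o a₂ w b] at hind
            have hH := crossA'so_a1v_edge hp hew o a₂ b
            have := mul_nonneg (sq_nonneg (1 - p e)) hind
            linarith [hH, this]
          · have htc : Conn ends (sureConfig p) a₁ t := ht
            have hre := crossA'so_reroot (R := R) p htc o a₂ v b
            have hsure := sureConfig_update_zero (R := R) p h1
            have htc0 : Conn ends (sureConfig (Function.update p e 0)) a₁ t := by
              rw [hsure]
              exact htc
            have hre0 := crossA'so_reroot (R := R) (Function.update p e 0) htc0 o a₂ v b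
            have hind1 := ih _ hp1 hcard1 a₁
            have hsure1 : sureConfig (Function.update p e 1) =
                Function.update (sureConfig p) e true := by
              funext f
              by_cases hf : f = e
              · subst hf
                simp [sureConfig]
              · simp [sureConfig, Function.update_of_ne hf]
            have htc1 : Conn ends (sureConfig (Function.update p e 1)) a₁ t := by
              rw [hsure1]
              exact conn_mono (fun f => by
                by_cases hf : f = e
                · subst hf; simp
                · simp [Function.update_of_ne hf]) htc
            have hre1 := crossA'so_reroot (R := R) (Function.update p e 1) htc1 o a₂ v b
            rw [hre0] at hind
            rw [hre1] at hind1
            have hH := H p t w e hp hew htw hw2 hwv h0 h1 hind hind1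
            rw [hre]
            have := mul_nonneg (sq_nonneg (1 - p e)) hind
            linarith [hH, this]

end Induction

end CrossAPrimeInduction

end Summit.Ventures.PercRepro2
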